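import Summits.QuantumFields.YangMills.Theorems.FluctuationComparisonRegPrIntLOrganTangentFibreMeanTailSplit
import HarnessLib

/-!
# Route `UnitScaleTilt` — crux `FluctuationComparisonRegPrIntL` (stmt-QuantumFields-20520, rung R3), PATH-B organ: «JT-INT» — THE (JT-h) INTEGRATION STEP
# (pointwise second-difference letters on the GOOD set + a crude letter on the law's support + the law's bad-set TAIL ⟹ the INTEGRATED transport bracket of `SpreadFibreLawH(J)`)

Cell `ym3-torus` (rung R3 = continuum `SU(2)` Yang–Mills on T³ — NOT d = 4, NOT infinite volume, NOT a mass gap, NOT Clay).  LEAD-20520 width seat `ym-ust-20520-w3` g26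
(DISCHARGE SPEC v1.0 §6 step 3); def-free, Mathlib + ✓TS only, `--supports stmt-QuantumFields-20520 --as helper`, default heartbeats, `autoImplicit false`.

WHAT (one abstract fibre `(Z, τ)`; in the discharge `w := ŵ_t(Xw,·)`, `F_X := h_Ts∘Φ(X,·)` at the four corners of a coarse one-bond square, `Good := {z | Φ(Xw,z)` deep in the
fine window`}`): ★★`abs_integral_secondDiff_mul_le_good_add_tail` — if the law `w` is `≥ 0`, integrable with `∫ w = 1` (✓`wgt_normalised`), its mass off the
measurable set `Good` is `≤ ES`, the transported second difference `ΔΔF := F_Y − F_V − F_W + F_U` is bounded by `AG` on `Good ∩ {w ≠ 0}` (the GOOD-SET POINTWISE CURVATURE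
LETTER — ✓`…PullbackSquareCurvOrgan.hClauseSq_of_curvSquare` (N3) on the window that square stability provides) and by `AB` on `{w ≠ 0}` (a CRUDE letter — link-indexed pull-back
✓2a-O∕✓RM-PB with the (β) Cauchy letters; polynomial in `L^m` is fine here), then `|∫ ΔΔF·w dτ| ≤ AG + AB·ES`.  With `AG = kG(B,B′)·sz·sz′`, `AB = kB(B,B′)·sz·sz′` this is the
(JT-h) bracket with `k′ := kG + ES·kB` (★`secondDiff_letter_bound`: the `sz·sz′` factoring and `0 ≤ k′`), row mass `≤ mass(kG) + ES·mass(kB)` (★`rowMass_add_smul_le`) — the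
m-UNIFORM part `NT·Dr·w` from `kG`, the super-polynomially small TAIL × polynomial crude mass in the `δT j·D_j` slot (px19 g20 LOCATE a69adec5 §0; census v5.0 §6 (a)).
Mechanism: truncate `ΔΔF` to `{w ≠ 0}` (the integral is unchanged), then ✓`abs_integral_mul_weight_le_good_add_bad_of_normalised` (LEAD w3 g25 ✓TS).

HONEST FRAMING: bookkeeping ([folklore]); the three inputs (good-set curvature letter, crude letter, tail) are HYPOTHESES here — in print [Balaban1985Variational] Thm 1 ∕ Prop 9,
[Balaban1987RG1] (0.22)–(0.30), [Balaban1985UV3] (47) tails; nothing of Bałaban's analysis is asserted or proved; `SpreadFibreLawH(J)` remain hypothesis rows; JVAR″, JEN″,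
LIN″, O1ᵘ-H v2.2, S1aᴴ, S3ᴴ, S2α′, S2β, 26243, the five registered stubs, crux 20520 and `YM3TorusSU2` are NOT proved; rung R3 = SU(2) YM₃ on T³ at fixed lattice data —
NOT d = 4, NOT infinite volume, NOT a mass gap, NOT Clay; the Yang–Mills mass gap is NOT proved.
-/

set_option autoImplicit false

noncomputable section

namespace Summit.QuantumFields.YangMills.Theorems.OrganTangentSecondDiffIntegration

open MeasureTheory
open Summit.QuantumFields.YangMills.Theorems.OrganTangentFibreMeanTailSplit (abs_integral_mul_weight_le_good_add_bad_of_normalised)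

variable {Z : Type*} [MeasurableSpace Z]

/-- ★★ **JT-INT** — pointwise letters on the good set and on the law's support, plus the law's bad-set tail, bound the INTEGRATED second difference:
`|∫ (F_Y − F_V − F_W + F_U)·w dτ| ≤ AG + AB·ES` (module docstring). [folklore] -/
theorem abs_integral_secondDiff_mul_le_good_add_tail (τ : Measure Z) (FU FV FW FY w : Z → ℝ) (Good : Set Z) (hGood : MeasurableSet Good)
    (hwi : Integrable w τ) (hwnn : ∀ z, 0 ≤ w z) (hwn : ∫ z, w z ∂τ = 1)
    (ES : ℝ) (htail : ∫ z in Goodᶜ, w z ∂τ ≤ ES)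
    (AG AB : ℝ) (hAG : 0 ≤ AG) (hAB : 0 ≤ AB)
    (hG : ∀ z ∈ Good, w z ≠ 0 → |FY z - FV z - FW z + FU z| ≤ AG)
    (hB : ∀ z, w z ≠ 0 → |FY z - FV z - FW z + FU z| ≤ AB) :
    |∫ z, (FY z - FV z - FW z + FU z) * w z ∂τ| ≤ AG + AB * ES := by
  classical
  -- truncate the second difference to the support of the law
  set D : Z → ℝ := fun z => if w z = 0 then 0 else FY z - FV z - FW z + FU z with hD
  have heq : (fun z => (FY z - FV z - FW z + FU z) * w z) = fun z => D z * w z := by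
    funext z
    by_cases hz : w z = 0
    · simp only [hD, hz, mul_zero]
    · simp only [hD, hz, if_false]
  have hDb : ∀ z, |D z| ≤ AB := by
    intro z
    by_cases hz : w z = 0
    · simp only [hD, hz, if_true, abs_zero]; exact hAB
    · simp only [hD, hz, if_false]; exact hB z hz
  have hDg : ∀ z ∈ Good, |D z| ≤ AG := by
    intro z hzG
    by_cases hz : w z = 0
    · simp only [hD, hz, if_true, abs_zero]; exact hAG
    · simp only [hD, hz, if_false]; exact hG z hzG hz
  rw [heq]
  have h := abs_integral_mul_weight_le_good_add_bad_of_normalised τ D w Good hGood AG AB hAG hDb hDg hwi hwnn hwn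
  have hbad : AB * (∫ z in Goodᶜ, w z ∂τ) ≤ AB * ES := mul_le_mul_of_nonneg_left htail hAB
  linarith

/-- The letter form: with `AG = kG·sz·sz′`, `AB = kB·sz·sz′` the bound is `(kG + ES·kB)·sz·sz′`, and the combined letter is `≥ 0`. [folklore] -/
theorem secondDiff_letter_bound {I kG kB ES sz sz' : ℝ} (hkG : 0 ≤ kG) (hkB : 0 ≤ kB) (hES : 0 ≤ ES)
    (hI : |I| ≤ kG * sz * sz' + kB * sz * sz' * ES) :
    0 ≤ kG + ES * kB ∧ |I| ≤ (kG + ES * kB) * sz * sz' :=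
  ⟨add_nonneg hkG (mul_nonneg hES hkB), hI.trans (le_of_eq (by ring))⟩

/-- Row masses add: `Σ_{B′} (kG + ES·kB) B B′·e^{κd} ≤ MG + ES·MB` from the two row masses (the m-uniform part and the tail × crude part of (JT-h)'s budget
`NT·Dr·w + δT j·D_j`). [folklore] -/
theorem rowMass_add_smul_le {ι : Type*} (s : Finset ι) (kG kB e : ι → ℝ) (ES MG MB : ℝ) (hES : 0 ≤ ES)
    (hG : ∑ i ∈ s, kG i * e i ≤ MG) (hB : ∑ i ∈ s, kB i * e i ≤ MB) :
    ∑ i ∈ s, (kG i + ES * kB i) * e i ≤ MG + ES * MB := by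
  have hsplit : ∑ i ∈ s, (kG i + ES * kB i) * e i = (∑ i ∈ s, kG i * e i) + ES * ∑ i ∈ s, kB i * e i := by
    rw [Finset.mul_sum, ← Finset.sum_add_distrib]
    exact Finset.sum_congr rfl fun i _ => by ring
  rw [hsplit]
  exact add_le_add hG (mul_le_mul_of_nonneg_left hB hES)

end Summit.QuantumFields.YangMills.Theorems.OrganTangentSecondDiffIntegration

end
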